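import Summits.Parity.BatemanHorn.Theorems.AlmostPrimeZerosSystemLSDRealSegmentSandwich
import HarnessLib

/-!
# Route `AlmostPrimeZeros`, crux `SystemLSDRealSegment` (stmt-Parity-11292), line
# `beta-thinned-root-kernel`: Rankin's trick for the smooth beyond-level tuples (`stub_smoothTail_rankin`)

Pointwise in the row `n`: for real `y ≥ 1`, `δ ≥ 0`, `x ≥ 1` and a smoothness height `S`, the sum of the tuple
weights `∏ᵢ h_y(dᵢ)` (`h_y = thinWeight y ≥ 0`) over the divisor tuples `d ∈ tuples f n` of level `∏ dᵢ > x`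
whose product is `S`-smooth is at most `x^{−δ} ∏ᵢ Σ_{e ∈ divSet fᵢ(n), e S-smooth} h_y(e) e^δ`.

Proof (Rankin's trick).  On a tuple with `x < ∏ dᵢ` insert the factor `(∏ dᵢ / x)^δ = x^{−δ} ∏ᵢ dᵢ^δ ≥ 1`
(the weights are `≥ 0`, `prod_thinWeight_nonneg`), then drop the level condition: a tuple whose product is
`S`-smooth has every coordinate `S`-smooth (`Nat.mem_smoothNumbers_of_dvd`), so the smooth tuples sit inside the
product set `∏ᵢ {e ∈ divSet fᵢ(n) : e S-smooth}`, over which the twisted weight `x^{−δ} ∏ᵢ h_y(dᵢ) dᵢ^δ ≥ 0`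
sums to the right-hand side (`Finset.prod_univ_sum`).  Pure finite combinatorics over Mathlib and the line's
vocabulary file `…/Theorems/AlmostPrimeZerosDefs.lean`.

References: R. A. Rankin, *J. London Math. Soc.* 13 (1938) (the trick); G. Tenenbaum, *Introduction to analytic
and probabilistic number theory* (2015), III.5; the line card
`Cruxes/SystemLSDRealSegment/Lines/beta-thinned-root-kernel.md`.
-/

open Filter Finset Polynomial
open scoped BigOperators Topology

namespace Summit.Parity.BatemanHorn.Cruxes.SystemLSDRealSegment.BetaThinnedRootKernel

open Literature.NumberTheory.Sieve

noncomputable section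

variable {k : ℕ}

/-- Abstract shape of the estimate: enlarge each term, then enlarge the index set over non-negative terms.
[folklore] -/
theorem sum_le_sum_of_subset_of_le_of_nonneg {ι : Type*} {s t : Finset ι} {w g : ι → ℝ} (hst : s ⊆ t)
    (hle : ∀ i ∈ s, w i ≤ g i) (hg : ∀ i ∈ t, 0 ≤ g i) : ∑ i ∈ s, w i ≤ ∑ i ∈ t, g i :=
  (Finset.sum_le_sum hle).trans (Finset.sum_le_sum_of_subset_of_nonneg hst fun i hi _ => hg i hi)

/-- The Rankin factor: for `1 ≤ x < ∏ᵢ dᵢ` and `δ ≥ 0`, `1 ≤ x^{−δ} ∏ᵢ dᵢ^δ`. [folklore] -/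
theorem one_le_rankinTupleFactor {x : ℕ} (hx : 1 ≤ x) {δ : ℝ} (hδ : 0 ≤ δ) (d : Fin k → ℕ)
    (hxd : x < ∏ i, d i) : 1 ≤ (x : ℝ) ^ (-δ) * ∏ i, ((d i : ℕ) : ℝ) ^ δ := by
  have hx0 : (0 : ℝ) < x := Nat.cast_pos.2 hx
  have hxP : (x : ℝ) ≤ ((∏ i, d i : ℕ) : ℝ) := Nat.cast_le.2 hxd.le
  rw [Real.finsetProd_rpow univ (fun i => ((d i : ℕ) : ℝ)) (fun i _ => Nat.cast_nonneg (d i)) δ,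
    ← Nat.cast_prod, Real.rpow_neg hx0.le, ← div_eq_inv_mul, ← Real.div_rpow (Nat.cast_nonneg _) hx0.le]
  exact Real.one_le_rpow ((one_le_div hx0).2 hxP) hδ

/-- Rankin's trick on one tuple: for `y ≥ 1`, `δ ≥ 0` and `1 ≤ x < ∏ᵢ dᵢ`,
`∏ᵢ h_y(dᵢ) ≤ x^{−δ} ∏ᵢ h_y(dᵢ) dᵢ^δ`. [folklore] -/
theorem prod_thinWeight_le_rankin {y : ℝ} (hy : 1 ≤ y) {δ : ℝ} (hδ : 0 ≤ δ) {x : ℕ} (hx : 1 ≤ x)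
    (d : Fin k → ℕ) (hxd : x < ∏ i, d i) :
    ∏ i, thinWeight y (d i) ≤ (x : ℝ) ^ (-δ) * ∏ i, (thinWeight y (d i) * ((d i : ℕ) : ℝ) ^ δ) := by
  rw [Finset.prod_mul_distrib, mul_left_comm]
  exact le_mul_of_one_le_right (prod_thinWeight_nonneg hy d) (one_le_rankinTupleFactor hx hδ d hxd)

/-- The twisted tuple weight `x^{−δ} ∏ᵢ h_y(dᵢ) dᵢ^δ` is `≥ 0` for `y ≥ 1`. [folklore] -/
theorem rankinWeight_nonneg {y : ℝ} (hy : 1 ≤ y) (δ : ℝ) (x : ℕ) (d : Fin k → ℕ) :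
    0 ≤ (x : ℝ) ^ (-δ) * ∏ i, (thinWeight y (d i) * ((d i : ℕ) : ℝ) ^ δ) := by
  rw [Finset.prod_mul_distrib]
  exact mul_nonneg (Real.rpow_nonneg (Nat.cast_nonneg _) _) (mul_nonneg (prod_thinWeight_nonneg hy d)
    (Finset.prod_nonneg fun i _ => Real.rpow_nonneg (Nat.cast_nonneg _) _))

/-- A tuple of divisors whose product is `S`-smooth has `S`-smooth coordinates: the smooth beyond-level tuples
lie in the product set of the smooth divisors. [folklore] -/
theorem filter_tuples_smooth_subset_piFinset (f : Fin k → ℤ[X]) (S x n : ℕ) :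
    (tuples f n).filter (fun d => x < ∏ i, d i ∧ (∏ i, d i) ∈ Nat.smoothNumbers S) ⊆
      Fintype.piFinset fun i => (divSet ((f i).eval (n : ℤ)).toNat).filter (· ∈ Nat.smoothNumbers S) := by
  intro d hd
  obtain ⟨hd, -, hsm⟩ := Finset.mem_filter.1 hd
  rw [Fintype.mem_piFinset]
  intro i
  exact Finset.mem_filter.2 ⟨Fintype.mem_piFinset.1 hd i,
    Nat.mem_smoothNumbers_of_dvd hsm (Finset.dvd_prod_of_mem d (Finset.mem_univ i))⟩

/-- **stub_smoothTail_rankin** (Rankin's trick, pointwise in the row `n`): for `y ≥ 1`, `δ ≥ 0`, `x ≥ 1`, the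
sum of the tuple weights over the `S`-smooth tuples of level `> x` is at most
`x^{−δ} ∏ᵢ Σ_{e ∣ fᵢ(n), e S-smooth} h_y(e) e^δ` (drop `x < ∏dᵢ` after inserting `(∏dᵢ/x)^δ ≥ 1`; the smooth
tuples form a product set). [folklore] -/
theorem stub_smoothTail_rankin :
    ∀ (k : ℕ) (f : Fin k → ℤ[X]) (y : ℝ), 1 ≤ y → ∀ δ : ℝ, 0 ≤ δ → ∀ (S x n : ℕ), 1 ≤ x →
      (∑ d ∈ (tuples f n).filter (fun d => x < ∏ i, d i ∧ (∏ i, d i) ∈ Nat.smoothNumbers S),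
          ∏ i, thinWeight y (d i)) ≤
        (x : ℝ) ^ (-δ) * ∏ i, ∑ e ∈ (divSet ((f i).eval (n : ℤ)).toNat).filter (· ∈ Nat.smoothNumbers S),
          thinWeight y e * (e : ℝ) ^ δ := by
  intro k f y hy δ hδ S x n hx
  rw [Finset.prod_univ_sum, Finset.mul_sum]
  refine sum_le_sum_of_subset_of_le_of_nonneg (filter_tuples_smooth_subset_piFinset f S x n)
    (fun d hd => ?_) (fun d _ => rankinWeight_nonneg hy δ x d)
  obtain ⟨-, hxd, -⟩ := Finset.mem_filter.1 hd
  exact prod_thinWeight_le_rankin hy hδ hx d hxd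

end

end Summit.Parity.BatemanHorn.Cruxes.SystemLSDRealSegment.BetaThinnedRootKernel
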